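import Summits.ResolutionOfSingularities.ResolutionOfSingularities.Theorems.HilbertSamuelEliminationSigmaMaxModificationsCorridor3WLadderIsoKernelCPSliceOrigin
import Literature.AlgebraicGeometry.Resolution.BlowupsIntegral
import HarnessLib

/-!
# [OURS · L1 W4.2] THE ISO-KERNEL SLICE IN COSSART–PILTANT'S FRAME — integrality of the stages DISCHARGED (only the origin stage is assumed
# integral): the point centres of an isolated point tower with singular marked points are nonzero ideals, so every stage is integral

Crux chain w42 (`SigmaMaxModifications`, stmt-ResolutionOfSingularities-18506; conjunct `SigmaMaxModificationsCorridor3`, stmt-…-19249),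
line `w_ladder`, registered stubs `stub_isoInsepTower` / `stub_isoSepRecurrent`. Lead res-L1-w42-lead-1 (gen 5). Helper file
`--supports stmt-ResolutionOfSingularities-19249`; kernel only (no definition, no new named fact; CONDITIONAL on `CossartPiltant2019LocalPermissible`).

WHAT IS PROVED. (`isIntegral_of_pointTower`) Along a tower of blow-ups in CLOSED POINT centres `C_n = {pt n}` whose bottom stage is integral and
whose marked points are SINGULAR, every stage is integral (`IsBlowup.isIntegral`: the centre ideal `𝓘_{x_n}` is nonzero — its stalk at `x_n` is
`𝔪_{x_n} ≠ 0`, a field being regular). Hence (`false_of_isIsoPointTower_pCyclic_of_CP_of_isIntegral`) the intrinsic slice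
`false_of_isIsoPointTower_pCyclic_of_CP'` (p557834) with `hint : ∀ n, IsIntegral (T.X n)` replaced by `IsIntegral (T.X 0)`: Cossart–Piltant's frame +
an isolated E3 point tower over an integral stage of finite type over a field (`ν ≠ Φ^{(N)}`, `dim 𝒪_{X_0,x_0} ≤ N`) whose origin stalk embeds into
`L` as a local ring of the germ `R[x]` containing `R` dominated ⇒ `False`, modulo the printed CP 2019 Thm. 1.5.

HONEST FRAMING. OURS bookkeeping; nothing here is a statement of H. Hironaka's manuscript [Hironaka2017] nor a new claim about [CossartPiltant2019].
AI-written; AI review is weaker than expert review.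

References: V. Cossart, O. Piltant, J. Algebra 529 (2019), Thm. 1.5 [CossartPiltant2019]; The Stacks Project, Tag 02ND (blowing up integral
schemes) [StacksProject].
-/

noncomputable section

set_option linter.dupNamespace false

open Polynomial IsLocalRing AlgebraicGeometry CategoryTheory TopologicalSpace
open Literature.AlgebraicGeometry.Resolution Literature.AlgebraicGeometry.CossartJannsenSaito2020 Literature.RingTheory.HilbertSamuel
open Scheme.IdealSheafData
open Summit.ResolutionOfSingularities.ResolutionOfSingularities.Cruxes.SigmaMaxModifications.IdeasL1Idea2R4 (IsIsoPointTower)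

namespace Summit.ResolutionOfSingularities.ResolutionOfSingularities.Cruxes.SigmaMaxModifications.IdeasL1C5

universe u

-- adapted from Literature/AlgebraicGeometry/Resolution/DiffIdealSupportOrder.lean (`stalkIdeal_bot''`)
/-- The stalks of the zero ideal sheaf vanish. [folklore] -/
private theorem stalkIdeal_bot' {X : Scheme.{u}} (x : X) : stalkIdeal (⊥ : X.IdealSheafData) x = ⊥ := by
  obtain ⟨U, hU, hxU, -⟩ := exists_isAffineOpen_mem_and_subset (X := X) (x := x) (U := ⊤) (TopologicalSpace.Opens.mem_top _)
  rw [stalkIdeal_eq_map_germ ⊥ ⟨U, hU⟩ hxU, Scheme.IdealSheafData.ideal_bot, Pi.bot_apply, Ideal.map_bot]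

section Integral

variable {T : BlowupTower.{u}} {pt : ∀ n, T.X n}

/-- **The point centres of a tower with singular marked points are NONZERO ideals**: the stalk of `𝓘_{x_n}` at `x_n` is `𝔪_{x_n}`, which is
nonzero since a field is a regular local ring. [folklore] -/
theorem vanishingIdeal_centre_ne_bot (hC : ∀ n, T.C n = {pt n}) (hcl : ∀ n, IsClosed ({pt n} : Set (T.X n)))
    (hsing : ∀ n, ¬ IsRegularLocalRing ((T.X n).presheaf.stalk (pt n))) (n : ℕ) :
    vanishingIdeal ⟨T.C n, T.isClosed_C n⟩ ≠ ⊥ := by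
  haveI := T.ln n
  intro hJ
  have h1 : stalkIdeal (vanishingIdeal ⟨T.C n, T.isClosed_C n⟩) (pt n) = maximalIdeal ((T.X n).presheaf.stalk (pt n)) := by
    refine stalkIdeal_vanishingIdeal_eq_maximalIdeal_of_closure_eq ?_
    change T.C n = closure {pt n}
    rw [(hcl n).closure_eq, hC n]
  rw [hJ, stalkIdeal_bot'] at h1
  exact hsing n (isRegularLocalRing_of_isField (IsLocalRing.isField_iff_maximalIdeal_eq.mpr h1.symm))

/-- **Every stage of a point tower over an integral stage with singular marked points is integral.** [cite: StacksProject, Tag 02ND] -/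
theorem isIntegral_of_pointTower (hint0 : IsIntegral (T.X 0)) (hC : ∀ n, T.C n = {pt n})
    (hcl : ∀ n, IsClosed ({pt n} : Set (T.X n))) (hsing : ∀ n, ¬ IsRegularLocalRing ((T.X n).presheaf.stalk (pt n))) :
    ∀ n, IsIntegral (T.X n)
  | 0 => hint0
  | n + 1 => by
    haveI := isIntegral_of_pointTower hint0 hC hcl hsing n
    haveI := T.ln n
    exact (T.isBlowup n).isIntegral (vanishingIdeal_centre_ne_bot hC hcl hsing n)

end Integral

/-! ## The slice with only the origin stage assumed integral -/

section SliceIntegral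

variable {L : Type u} [Field L]

/-- **THE ISO-KERNEL SLICE IN COSSART–PILTANT'S FRAME — origin stage integral, later stages derived (modulo print).** As
`false_of_isIsoPointTower_pCyclic_of_CP'` (p557834) with `∀ n, IsIntegral (T.X n)` replaced by `IsIntegral (T.X 0)`: the marked points are singular
(`H = ν ≠ Φ^{(N)}`, `dim ≤ N`), so the point centres are nonzero ideals and every blown-up stage is again integral.
[cite: CossartPiltant2019, Thm. 1.5 (arXiv v1: Thm. 1.4)] [cite: StacksProject, Tag 02ND] -/
theorem false_of_isIsoPointTower_pCyclic_of_CP_of_isIntegral (hCP : CossartPiltant2019LocalPermissible.{u})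
    (p : ℕ) (hp : p.Prime) (R : Subring L) [IsRegularLocalRing R]
    (hexc : IsExcellentRing R) (hdim : ringKrullDim R = 3) (hchar : CharP (ResidueField R) p)
    (h : R[X]) (x : L) (hmon : h.Monic) (hdeg : h.natDegree = p) (hx : aeval x h = 0)
    (hmin : ∀ g : R[X], g.natDegree < p → aeval x g = 0 → g = 0)
    (hgen : ∀ z : L, ∃ (g : R[X]) (s : R), s ≠ 0 ∧ z * s = aeval x g)
    (hcase : (CharP L p ∧ ∀ i, 0 < i → i < p → h.coeff i = 0) ∨
      (Nat.card (L ≃ₐ[R] L) = p ∧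
        ∀ σ : L ≃ₐ[R] L, ∀ y ∈ Algebra.adjoin R ({x} : Set L), σ y ∈ Algebra.adjoin R ({x} : Set L)))
    {N : ℕ} {ν : ℕ → ℕ} {T : BlowupTower.{u}} {pt : ∀ n, T.X n} (hT : IsIsoPointTower N ν T pt)
    [hint0 : IsIntegral (T.X 0)]
    {k : Type u} [Field k] (g : T.X 0 ⟶ Spec (.of k)) [LocallyOfFiniteType g]
    (hνΦ : ν ≠ iterPSum N Phi) (hd0 : ringKrullDim ((T.X 0).presheaf.stalk (pt 0)) ≤ N)
    (θ₀ : (T.X 0).presheaf.stalk (pt 0) →+* L) (h₀ : Function.Injective θ₀)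
    (hR0 : R ≤ θ₀.range) (hRdom : SubringDominates R θ₀.range)
    (hB : (Algebra.adjoin R ({x} : Set L)).toSubring ≤ θ₀.range)
    (hfrac : ∀ w ∈ θ₀.range, ∃ y ∈ (Algebra.adjoin R ({x} : Set L)).toSubring, ∃ z ∈ (Algebra.adjoin R ({x} : Set L)).toSubring,
      z⁻¹ ∈ θ₀.range ∧ w = y / z) :
    False := by
  -- the marked points are singular: `H = ν ≠ Φ^{(N)}` with `dim 𝒪_{X_n,x_n} ≤ dim 𝒪_{X_0,x_0} ≤ N`
  have hsing : ∀ n, ¬ IsRegularLocalRing ((T.X n).presheaf.stalk (pt n)) := by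
    intro n hreg
    haveI := T.ln n
    obtain ⟨d, hd⟩ := exists_nat_cast_eq_ringKrullDim (R := (T.X n).presheaf.stalk (pt n))
    have hdN : d ≤ N := by
      have hle := (ringKrullDim_stalk_pt_le hT.2.1 n).trans hd0
      rw [hd] at hle
      exact_mod_cast hle
    have hΦ : Scheme.hsFun (T.X n) N (pt n) = iterPSum N Phi :=
      (Scheme.mem_regularLocus_iff_hsFun_eq (pt n) hd hdN).mp hreg
    exact hνΦ ((hT.2.2.2.1 n).symm.trans hΦ)
  exact false_of_isIsoPointTower_pCyclic_of_CP' hCP p hp R hexc hdim hchar h x hmon hdeg hx hmin hgen hcase hT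
    (isIntegral_of_pointTower hint0 hT.1 hT.2.2.1 hsing) g hνΦ hd0 θ₀ h₀ hR0 hRdom hB hfrac

end SliceIntegral

end Summit.ResolutionOfSingularities.ResolutionOfSingularities.Cruxes.SigmaMaxModifications.IdeasL1C5

end
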